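import Mathlib

/-!
# T5Multilinear — the quantifier step of T5-ID §ID-2 / T4-A3 Lemma A7.3(b), kernel form

The Tier-4 gap (N) is «∫_S f_1^*e ∧ ⋯ ∧ f_4^*e ≠ 0 for SOME admissible choice of the data», and
the Tier-5 identification sub-step (route/T5-ID-p2.md, Theorem ID(ii)/(v)) reduces it to the
non-vanishing of the same 4-linear functional on the ℂ-spans of the admissible pull-backs.  The
step is the following elementary fact: a multilinear map over a field which vanishes on every
tuple drawn from spanning sets vanishes identically; contrapositively, if it is non-zero at some
tuple of vectors of the spans, it is non-zero at some tuple of the spanning sets themselves.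

* `MultilinearMap.eq_zero_of_forall_mem_eq_zero` — vanishing on spanning sets ⟹ zero;
* `MultilinearMap.exists_mem_ne_zero_of_ne_zero` — the contrapositive, in the form used:
  from `f v ≠ 0` with `v i ∈ span K (s i)` to `∃ w, (∀ i, w i ∈ s i) ∧ f w ≠ 0`.

For the two conjugate-linear slots of (N) one applies the statement with the conjugate
ℂ-structure on those slots (a ℂ-antilinear map is ℂ-linear for the conjugate structure, and
ℂ-subspaces are the same subsets), as the prose of T5-ID §ID-2(c) records.
-/

namespace Summit.Ventures.HodgeRepro2.T5Multilinear

variable {ι : Type*} [Finite ι] {K : Type*} [Field K]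
variable {M : ι → Type*} [∀ i, AddCommGroup (M i)] [∀ i, Module K (M i)]
variable {N : Type*} [AddCommGroup N] [Module K N]

/-- A multilinear map over a field that vanishes on every tuple drawn from spanning sets
`s i` (with `span K (s i) = ⊤` for each slot) is zero. -/
theorem MultilinearMap.eq_zero_of_forall_mem_eq_zero (f : MultilinearMap K M N)
    (s : ∀ i, Set (M i)) (hs : ∀ i, Submodule.span K (s i) = ⊤)
    (h : ∀ v : ∀ i, M i, (∀ i, v i ∈ s i) → f v = 0) : f = 0 := by
  classical
  -- in each slot extract a basis contained in `s i`
  have hb : ∀ i, ∃ b : Set (M i), b ⊆ s i ∧ Submodule.span K b = Submodule.span K (s i) ∧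
      LinearIndependent K (fun x : b => (x : M i)) := fun i => exists_linearIndependent K (s i)
  choose b hbs hbspan hbli using hb
  let e : ∀ i, Module.Basis (b i) K (M i) := fun i =>
    Module.Basis.mk (hbli i) (by rw [Subtype.range_coe, hbspan i, hs i])
  refine Module.Basis.ext_multilinear e fun v => ?_
  simp only [zero_apply]
  refine h _ fun i => ?_
  simp only [e, Module.Basis.mk_apply]
  exact hbs i (v i).2

/-- The contrapositive in the form used by T5-ID §ID-2 / Lemma A7.3(b): if the multilinear
functional is non-zero at some tuple of vectors of the spans of the `s i`, it is non-zero at some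
tuple drawn from the `s i` themselves (an «admissible choice»). -/
theorem MultilinearMap.exists_mem_ne_zero_of_ne_zero (f : MultilinearMap K M N)
    (s : ∀ i, Set (M i)) (v : ∀ i, M i) (hv : ∀ i, v i ∈ Submodule.span K (s i))
    (hf : f v ≠ 0) : ∃ w : ∀ i, M i, (∀ i, w i ∈ s i) ∧ f w ≠ 0 := by
  classical
  by_contra hcon
  push Not at hcon
  -- restrict `f` to the product of the spans and apply the previous theorem there
  let P : ∀ i, Submodule K (M i) := fun i => Submodule.span K (s i)
  let g : MultilinearMap K (fun i => P i) N :=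
    f.compLinearMap fun i => (P i).subtype
  have hg : g = 0 := by
    refine MultilinearMap.eq_zero_of_forall_mem_eq_zero g
      (fun i => ((↑) : P i → M i) ⁻¹' s i) (fun i => ?_) (fun w hw => ?_)
    · -- the preimage of `s i` spans `P i`
      rw [eq_top_iff]
      rintro ⟨x, hx⟩ -
      have hx' : x ∈ Submodule.span K (s i) := hx
      refine Submodule.span_induction (p := fun y hy => (⟨y, hy⟩ : P i) ∈
          Submodule.span K (((↑) : P i → M i) ⁻¹' s i)) ?_ ?_ ?_ ?_ hx'
      · intro y hy
        exact Submodule.subset_span (by simpa using hy)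
      · exact Submodule.zero_mem _
      · intro y z hy hz hy' hz'
        exact Submodule.add_mem _ hy' hz'
      · intro a y hy hy'
        exact Submodule.smul_mem _ a hy'
    · have := hcon (fun i => (w i : M i)) (fun i => hw i)
      simpa [g] using this
  have : g (fun i => ⟨v i, hv i⟩) = f v := by simp [g]
  rw [hg] at this
  exact hf (by simpa using this.symm)

end Summit.Ventures.HodgeRepro2.T5Multilinear
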